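import Literature.MathematicalPhysics.QuantumFieldTheory.Balaban1983to89.B12EuclClause263
import Literature.MathematicalPhysics.QuantumFieldTheory.Balaban1983to89.B12GaugeOrbits021
import Literature.MathematicalPhysics.QuantumFieldTheory.Balaban1983to89.BlockAveragingTwoLevel

/-!
# `Balaban1983to89.B12RegularClassInvariance263` — T. Bałaban, *Renormalization group approach to lattice gauge field
theories. I*, Commun. Math. Phys. **109** (1987) 249–301 [Balaban1987RG1], §0 p. 254 / §1 pp. 259–263:
**THE REGULAR CLASSES `{U : |U(∂p) − 1| < δ}` ARE INVARIANT UNDER THE EUCLIDEAN TRANSFORMATIONS OF THE TORUS**, and the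
six class/domain hypotheses of `B12EuclClause263.action_comp_background_invariant` (r09 g10) DISCHARGED for the printed
regular class and domains.

HONEST FRAMING (cell `lit-balaban`, verbatim): statement-level skeleton of published theorems with citation tags; proofs where landed; nothing here is a claim about the Yang–Mills mass gap.

THE PRINT (v1.3: the three sentences below re-quoted VERBATIM from the held text, replacing v1.0–v1.2's paraphrases —
referee `lit-balaban-ref-5` P2 gen 27, F4-minor).  p. 254 [PDF 6]: *«We are interested in functions restricted to small
field regions, which in this case means that the function ρ and the integral in (0.13) are restricted to regular
configurations U, i.e. configurations satisfying bounds |U(∂p) − 1| < ε₀, p ∈ T, with ε₀ positive and sufficiently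
small, and we consider Tρ on configurations V satisfying similar bounds on T⁽¹⁾.»*  p. 260 [PDF 12] ((1.1)): *«They are
determined by regular gauge field configurations V given on the unit lattice T₁⁽ᵏ⁾. The regularity means that the
plaquette variables of V are small, |V(∂p′) − 1| < ε′₀ for p′ ∈ T₁⁽ᵏ⁾. For such a configuration there exists exactly
one regular, critical orbit of the functional U → A(U), U : Ū^k = M^k(U) = V on T⁽ᵏ⁾, (1.1)»* (the background field
`U_k(V)`; [15] Thm 1).  p. 259 [PDF 11] (before Theorem 1): *«To formulate this theorem we introduce small field domains.
For the k-th action such a domain is determined by the condition |∂U_k(V) − 1| < ε₀η² on T_η, for ε₀ sufficiently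
small. Another possible definition, technically less convenient, is given by the condition |∂V − 1| < ε₀ on T₁⁽ᵏ⁾.»*
p. 263 [PDF 15]: *«Other symmetries are Euclidean lattice transformations. We assume that the action (1.3) is invariant
with respect to the transformations of the lattice T⁽ᵏ⁾. More precisely, we notice that the explicitly defined
expressions in the j-th term in (1.3) are invariant with respect to the Euclidean transformations of the lattice
T⁽ʲ⁺¹⁾, and we assume that this is true for all expressions in this term.»* (the sentences `B12EuclClause263` quotes).
The reading «hence V ↦ A_k(U_k(V)) is invariant under the transformations of T⁽ᵏ⁾ for the regular class and the
small-field domains» is THIS LINEAGE'S gloss of these sentences (what the theorems below prove), not a printed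
sentence.  PDF held: `paper:balaban1987-cmp109-rg-i-small-field` (journal page = PDF page + 248).

WHAT THIS MODULE GIVES (theorems only; no definition, no new `Prop`-fact, no sorry; axioms standard).
* §1 — for ANY inversion- and conjugation-invariant function `f` on the group (`f g⁻¹ = f g`, `f (h g h⁻¹) = f g`; e.g.
  `Re tr`, the tree's `reTr_plaqHol_permute/reflect`, and `dist1 = |· − 1|`): `f` of a plaquette variable of a permuted /
  reflected / centre-reflected / translated / gauge-transformed configuration is `f` of the plaquette variable of the
  configuration at the transformed plaquette (`apply_plaqHol_permute`, `apply_plaqHol_reflect`, `apply_plaqHol_creflect`,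
  `apply_plaqHol_translate`, `apply_plaqHol_gaugeAct`) — orientation reversal and change of corner are an inversion and a
  conjugation, invisible to `f`;
* §2 — the `dist1` instances (permute / creflect / translate; reflect = `apply_plaqHol_reflect dist1_inv dist1_conj`) and **the regular classes `Setup.PlaqSmall δ` (all plaquettes) are invariant** under
  translations, axis reflections, centre reflections, coordinate permutations and gauge transformations
  (`plaqSmall_translate_iff`, `plaqSmall_reflect_iff`, `plaqSmall_creflect_iff`, `plaqSmall_permute_iff`); the restricted
  classes `PlaqSmallOn S δ` transform with the image set of plaquettes; the characteristic function `chiSmall univ δ`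
  (the restriction factor of (0.13); `chiSmall_congr_of_iff`/`plaqSmallOn_iff_of_chiSmall_eq`: `χ` sees exactly the class) is
  `EuclInvariantC` on every torus, `NestedInvariant j` on `T_η` for every `j`, and gauge invariant;
  the alternative small-field domain of p. 259 `B12SmallFieldDomain259.smallFieldDomAlt` is invariant;
* §3 — **the hypotheses `hregT/hregC/hregP/hdomT/hdomC/hdomP` of `B12EuclClause263.action_comp_background_invariant`
  DISCHARGED** when the regular class `bg.reg` and the domain `bg.dom k` of the background data are `PlaqSmall` level
  sets (print's (0.21)/(1.1)–(1.2)): `action_comp_background_invariant_plaqSmall` — what remains are the nested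
  covariance of the averagings, the uniqueness of the minimal orbit ([15] Thm 1, `UniqueModGauge`) and the two
  invariances of `A_k` (gauge, nested Euclidean), exactly the printed «above assumptions»;
* §4 — **the small-field domain of Theorem 1** `B12SmallFieldDomain259.smallFieldDom bg ε₀ k` (`V ∈ dom`,
  `|∂U_k(V) − 1| < ε₀η²`) **is invariant under the transformations of `T⁽ᵏ⁾`** under the same data hypotheses
  (`smallFieldDom_translate_iff`, `_creflect_iff`, `_permute_iff`): the minimiser of the transformed `V` is the
  transformed minimiser up to a gauge transformation (`IsBackground.translate/creflect/permute` + `UniqueModGauge`),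
  and `PlaqSmall` is both Euclidean and gauge invariant.
HONEST SCOPE. Elementary lattice bookkeeping the print leaves implicit; nothing of [15] (existence/uniqueness of the
minimal orbit) is asserted — it enters as the hypothesis `UniqueModGauge` exactly as in `B12EuclClause263` §7.
v1.1 (same seat, APPEND-ONLY; v1.0 = p303601 commit a2f7af7acd12, every v1.0 declaration byte-identical; + import
`BlockAveragingTwoLevel`): new § 5 — **[I]'s own two-level average (0.12) in the torus-side typing
`BlockAveragingTwoLevel.blockAvg₂ 𝓜 ℰ` IS NESTED-COVARIANT** (`blockAvg₂_nestedCovariant`, from the tree's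
`blockAvg₂_translate/creflect/permute`), so the hypothesis `hav` of §§ 3–4 is DISCHARGED for it: the transform of a
constrained minimiser is a constrained minimiser of the transformed constraint with NO uniqueness input
(`isBackground_blockAvg₂_translate/creflect/permute`), and — given [15] Thm 1's uniqueness modulo gauge and the two
invariances of `A_k` — `V ↦ A_k(U_k(V))` is invariant under the transformations of `T⁽ᵏ⁾` for the printed average,
regular class and domain (`action_comp_background_invariant_blockAvg₂`, `smallFieldDom_blockAvg₂_invariant`); at the
level of the tower (1.3): `action13_comp_background_invariant_blockAvg₂` (inputs: the inductive hypotheses `SFHyp`,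
the p. 263 clause `EuclClause263`, the (1.9)/(1.10) intertwining, gauge invariance of the explicit `log Z⁽ʲ⁾`,
[15] Thm 1 as `UniqueModGauge`).
v1.2 (same seat, APPEND-ONLY; v1.1 = p303791 commit 50051212a3db, every earlier declaration byte-identical): new § 6 — the
same for [I]'s FIRST definition, the symmetric one-level block averaging (0.4) `BlockAveraging.blockAvg ℰ` (p. 254: «both
definitions are equally good for our purposes»): `blockAvg_nestedCovariant` (from the tree's `blockAvg_translate/creflect/
permute`), `action_comp_background_invariant_blockAvg`, `action13_comp_background_invariant_blockAvg`; and for the axial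
(decimation) averaging of `AveragingRT` (= `blockAvg` with the trivial loop average): `action13_comp_background_invariant_axial`
over `B12EuclClause263.axial_nestedCovariant'`.
v1.3 (same seat, DOC-ONLY: the module header's THE PRINT paragraph re-quoted verbatim; every declaration byte-identical
to v1.2 = p303946 commit 62554ee9ab86).
Unit `lit-balaban-r09` (reader/typer r09 gen 11, B12 display owner; TAKING line HOME/STATUS.md 2026-08-21T20:17Z; rows
B12.Txt@263b / B12.Eq0.13 / B12.Eq1.2 / B12.Def@259), HOME `run/shared/lean/pub/lit-balaban/`.

DOCFIX (unit `lit-balaban-r09` gen 13): the seven [Balaban1988Convergent] «(1.4) p.247» locators of § 2 → «(1.4) p.246» (CMP 119 p. 246 carries (1.1)–(1.4); CITELOC row P34-003 of `pub-balaban` summit-lit1, confirmed on the page image `…/1988-cmp119-convergent-renormalization-p004-x2.png` by this seat); no declaration, statement or proof changed.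
-/

namespace Literature.MathematicalPhysics.QuantumFieldTheory.Balaban1983to89.B12RegularClassInvariance263

open Literature.MathematicalPhysics.QuantumFieldTheory.Balaban1983to89

/-! ## §1. Plaquette variables of transformed configurations, through an orientation-blind class function -/

section ClassFun

variable {P : Params} {j : ℕ} {G : Type*} [GaugeGroup G] {α : Type*} {f : G → α}

/-- Reversing the orientation of an elementary square inverts its holonomy, which `f` does not see.
[cite: Balaban1987RG1, (0.13) p.254] -/
theorem apply_holAt_swap (hinv : ∀ g, f g⁻¹ = f g) (U : GaugeField P j G) (x : Site P j) (a b : Fin P.d) :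
    f (GaugeField.holAt U x b a) = f (GaugeField.holAt U x a b) := by
  rw [GaugeField.holAt_swap, hinv]

/-- `f` of the plaquette variable of `mkOrdered x a b` is `f` of the oriented holonomy `GaugeField.holAt U x a b`.
[cite: Balaban1987RG1, (0.13) p.254] -/
theorem apply_plaqHol_mkOrdered (hinv : ∀ g, f g⁻¹ = f g) (U : GaugeField P j G) (x : Site P j) (a b : Fin P.d)
    (h : a ≠ b) : f (GaugeField.plaqHol U (Plaq.mkOrdered x a b h)) = f (GaugeField.holAt U x a b) := by
  unfold Plaq.mkOrdered
  split_ifs with hab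
  · rfl
  · exact apply_holAt_swap hinv U x a b

/-- **Coordinate permutations**: `f((π·U)(∂p)) = f(U(∂(π·p)))`. [cite: Balaban1987RG1, (2.17) p.269] -/
theorem apply_plaqHol_permute (hinv : ∀ g, f g⁻¹ = f g) (π : Equiv.Perm (Fin P.d)) (U : GaugeField P j G)
    (p : Plaq P j) : f (GaugeField.plaqHol (U.permute π) p) = f (GaugeField.plaqHol U (p.permute π)) := by
  rw [GaugeField.plaqHol_eq_holAt, GaugeField.holAt_permute, Plaq.permute, apply_plaqHol_mkOrdered hinv]

/-- `f(g₁⁻¹ g₄ g₃ g₂⁻¹) = f(g₁ g₂ g₃⁻¹ g₄⁻¹)` (a conjugate of the inverse). [cite: Balaban1987RG1, (0.13) p.254] -/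
theorem apply_pattern₁ (hinv : ∀ g, f g⁻¹ = f g) (hconj : ∀ g h, f (h * g * h⁻¹) = f g) (g₁ g₂ g₃ g₄ : G) :
    f (g₁⁻¹ * g₄ * g₃ * g₂⁻¹) = f (g₁ * g₂ * g₃⁻¹ * g₄⁻¹) := by
  have h : g₁⁻¹ * g₄ * g₃ * g₂⁻¹ = g₁⁻¹ * (g₁ * g₂ * g₃⁻¹ * g₄⁻¹)⁻¹ * g₁⁻¹⁻¹ := by group
  rw [h, hconj, hinv]

/-- `f(g₃ g₂⁻¹ g₁⁻¹ g₄) = f(g₁ g₂ g₃⁻¹ g₄⁻¹)` (a conjugate of the inverse). [cite: Balaban1987RG1, (0.13) p.254] -/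
theorem apply_pattern₂ (hinv : ∀ g, f g⁻¹ = f g) (hconj : ∀ g h, f (h * g * h⁻¹) = f g) (g₁ g₂ g₃ g₄ : G) :
    f (g₃ * g₂⁻¹ * g₁⁻¹ * g₄) = f (g₁ * g₂ * g₃⁻¹ * g₄⁻¹) := by
  have h : g₃ * g₂⁻¹ * g₁⁻¹ * g₄ = g₄⁻¹ * (g₁ * g₂ * g₃⁻¹ * g₄⁻¹)⁻¹ * g₄⁻¹⁻¹ := by group
  rw [h, hconj, hinv]

/-- **Axis reflections**: `f((r_μU)(∂p)) = f(U(∂(r_μ p)))` — for `μ` a direction of `p` the image square is traversed in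
the opposite sense from another corner, a conjugate of the inverse (the tree's `reTr_plaqHol_reflect`, verbatim for a
general `f`; the `dist1` instance is `apply_plaqHol_reflect dist1_inv dist1_conj` — stated summit-side as
`HistoryChessboardPlaquetteBox.dist1_plaqHol_reflect`, which `Literature/` cannot import, so it is not re-declared here).
[cite: Balaban1987RG1, (2.17) p.269] -/
theorem apply_plaqHol_reflect (hinv : ∀ g, f g⁻¹ = f g) (hconj : ∀ g h, f (h * g * h⁻¹) = f g) (μ : Fin P.d)
    (U : GaugeField P j G) (p : Plaq P j) : f (GaugeField.plaqHol (U.reflect μ) p) = f (GaugeField.plaqHol U (p.reflect μ)) := by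
  obtain ⟨x, a, b, hab⟩ := p
  simp only [GaugeField.plaqHol_eq_holAt, Plaq.reflect]
  by_cases ha : a = μ
  · subst ha
    rw [if_pos (Or.inl rfl)]
    have hb : b ≠ a := hab.ne'
    have e1 : U.reflect a ⟨x, a⟩ = (U ⟨(x.shift a).reflect a, a⟩)⁻¹ := by
      simp [GaugeField.reflect_apply, PBond.reflect]
    have e2 : U.reflect a ⟨x.shift a, b⟩ = U ⟨(x.shift a).reflect a, b⟩ := by
      simp [GaugeField.reflect_apply, PBond.reflect, hb]
    have e3 : U.reflect a ⟨x.shift b, a⟩ = (U ⟨((x.shift a).reflect a).shift b, a⟩)⁻¹ := by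
      simp [GaugeField.reflect_apply, PBond.reflect, Site.shift_comm x b a, Site.shift_reflect_of_ne a _ hb]
    have e4 : U.reflect a ⟨x, b⟩ = U ⟨((x.shift a).reflect a).shift a, b⟩ := by
      simp [GaugeField.reflect_apply, PBond.reflect, hb, Site.shift_reflect_shift]
    simp only [GaugeField.holAt, e1, e2, e3, e4, inv_inv]
    exact apply_pattern₁ hinv hconj _ _ _ _
  · by_cases hb : b = μ
    · subst hb
      rw [if_pos (Or.inr rfl)]
      have e1 : U.reflect b ⟨x, a⟩ = U ⟨((x.shift b).reflect b).shift b, a⟩ := by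
        simp [GaugeField.reflect_apply, PBond.reflect, ha, Site.shift_reflect_shift]
      have e2 : U.reflect b ⟨x.shift a, b⟩ = (U ⟨((x.shift b).reflect b).shift a, b⟩)⁻¹ := by
        simp [GaugeField.reflect_apply, PBond.reflect, Site.shift_comm x a b, Site.shift_reflect_of_ne b _ ha]
      have e3 : U.reflect b ⟨x.shift b, a⟩ = U ⟨(x.shift b).reflect b, a⟩ := by
        simp [GaugeField.reflect_apply, PBond.reflect, ha]
      have e4 : U.reflect b ⟨x, b⟩ = (U ⟨(x.shift b).reflect b, b⟩)⁻¹ := by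
        simp [GaugeField.reflect_apply, PBond.reflect]
      simp only [GaugeField.holAt, e1, e2, e3, e4, inv_inv]
      exact apply_pattern₂ hinv hconj _ _ _ _
    · rw [if_neg (not_or.mpr ⟨ha, hb⟩)]
      congr 1
      simp [GaugeField.holAt, GaugeField.reflect_apply, PBond.reflect, ha, hb, Site.shift_reflect_of_ne μ _ ha,
        Site.shift_reflect_of_ne μ _ hb]

omit [GaugeGroup G] in
/-- **Translations**: `(τ_aU)(∂p) = U(∂(p + a))` on the nose (the tree's `plaqHol_translate`).
[cite: Balaban1987RG1, (2.17) p.269] -/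
theorem apply_plaqHol_translate [GaugeGroup G] (f : G → α) (a : Site P j) (U : GaugeField P j G) (p : Plaq P j) :
    f (GaugeField.plaqHol (U.translate a) p) = f (GaugeField.plaqHol U (p.translate a)) := by
  rw [GaugeField.plaqHol_translate]

/-- **Centre reflections** (2.17) (`creflect ρ = reflect ρ ∘ translate (−e_ρ)`): `f((c_ρU)(∂p)) = f(U(∂q))` with
`q = τ_{−e_ρ}(r_ρ p)`. [cite: Balaban1987RG1, (2.17) p.269] -/
theorem apply_plaqHol_creflect (hinv : ∀ g, f g⁻¹ = f g) (hconj : ∀ g h, f (h * g * h⁻¹) = f g) (ρ : Fin P.d)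
    (U : GaugeField P j G) (p : Plaq P j) :
    f (GaugeField.plaqHol (U.creflect ρ) p) = f (GaugeField.plaqHol U ((p.reflect ρ).translate ((0 : Site P j).unshift ρ))) := by
  rw [GaugeField.creflect_eq, apply_plaqHol_reflect hinv hconj, GaugeField.plaqHol_translate]

/-- **Gauge transformations**: `U^u(∂p) = u(x)U(∂p)u(x)⁻¹`, so `f(U^u(∂p)) = f(U(∂p))`.
[cite: Balaban1987RG1, (0.13) p.254] -/
theorem apply_plaqHol_gaugeAct (hconj : ∀ g h, f (h * g * h⁻¹) = f g) (u : GaugeTransf P j G)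
    (U : GaugeField P j G) (p : Plaq P j) : f (GaugeField.plaqHol (GaugeField.gaugeAct u U) p) = f (GaugeField.plaqHol U p) := by
  have : GaugeField.plaqHol (GaugeField.gaugeAct u U) p = u p.src * GaugeField.plaqHol U p * (u p.src)⁻¹ := by
    simp only [GaugeField.plaqHol, GaugeField.gaugeAct, PBond.tgt, Site.shift_comm p.src p.ν p.μ]
    group
  rw [this, hconj]

end ClassFun

/-! ## §2. `dist1 = |· − 1|` and the regular classes `{U : |U(∂p) − 1| < δ}` -/

section Regular

variable {P : Params} {j : ℕ} {G : Type*} [GaugeGroup G]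

/-- `|(π·U)(∂p) − 1| = |U(∂(π·p)) − 1|`. [cite: Balaban1987RG1, (2.17) p.269] -/
theorem dist1_plaqHol_permute (π : Equiv.Perm (Fin P.d)) (U : GaugeField P j G) (p : Plaq P j) :
    dist1 (GaugeField.plaqHol (U.permute π) p) = dist1 (GaugeField.plaqHol U (p.permute π)) :=
  apply_plaqHol_permute GaugeGroup.dist1_inv π U p

/-- `|(c_ρU)(∂p) − 1| = |U(∂q) − 1|`, `q = τ_{−e_ρ}(r_ρ p)`. [cite: Balaban1987RG1, (2.17) p.269] -/
theorem dist1_plaqHol_creflect (ρ : Fin P.d) (U : GaugeField P j G) (p : Plaq P j) :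
    dist1 (GaugeField.plaqHol (U.creflect ρ) p) = dist1 (GaugeField.plaqHol U ((p.reflect ρ).translate ((0 : Site P j).unshift ρ))) :=
  apply_plaqHol_creflect GaugeGroup.dist1_inv GaugeGroup.dist1_conj ρ U p

/-- `|(τ_aU)(∂p) − 1| = |U(∂(p + a)) − 1|`. [cite: Balaban1987RG1, (2.17) p.269] -/
theorem dist1_plaqHol_translate (a : Site P j) (U : GaugeField P j G) (p : Plaq P j) :
    dist1 (GaugeField.plaqHol (U.translate a) p) = dist1 (GaugeField.plaqHol U (p.translate a)) :=
  apply_plaqHol_translate dist1 a U p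

/-- `Re tr (c_ρU)(∂p) = Re tr U(∂q)` (the centre-reflection companion of the tree's `reTr_plaqHol_reflect`).
[cite: Balaban1987RG1, (2.17) p.269] -/
theorem reTr_plaqHol_creflect (ρ : Fin P.d) (U : GaugeField P j G) (p : Plaq P j) :
    reTr (GaugeField.plaqHol (U.creflect ρ) p) = reTr (GaugeField.plaqHol U ((p.reflect ρ).translate ((0 : Site P j).unshift ρ))) :=
  apply_plaqHol_creflect GaugeGroup.reTr_inv GaugeGroup.reTr_conj ρ U p

/-- **The regular class `{U : |U(∂p) − 1| < δ, all p}` is translation invariant.** [cite: Balaban1987RG1, §1 p.263] -/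
theorem plaqSmall_translate_iff (δ : ℝ) (a : Site P j) (U : GaugeField P j G) :
    PlaqSmall δ (U.translate a) ↔ PlaqSmall δ U := by
  simp only [PlaqSmall, dist1_plaqHol_translate]
  exact (Plaq.translateEquiv a).forall_congr (fun _ => Iff.rfl)

/-- **The regular class is invariant under the axis reflections.** [cite: Balaban1987RG1, §1 p.263] -/
theorem plaqSmall_reflect_iff (δ : ℝ) (μ : Fin P.d) (U : GaugeField P j G) :
    PlaqSmall δ (U.reflect μ) ↔ PlaqSmall δ U := by
  simp only [PlaqSmall, apply_plaqHol_reflect GaugeGroup.dist1_inv GaugeGroup.dist1_conj]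
  exact (Plaq.reflectEquiv μ).forall_congr (fun _ => Iff.rfl)

/-- **The regular class is invariant under the centre reflections (2.17).** [cite: Balaban1987RG1, §1 p.263] -/
theorem plaqSmall_creflect_iff (δ : ℝ) (ρ : Fin P.d) (U : GaugeField P j G) :
    PlaqSmall δ (U.creflect ρ) ↔ PlaqSmall δ U := by
  rw [GaugeField.creflect_eq, plaqSmall_reflect_iff, plaqSmall_translate_iff]

/-- **The regular class is invariant under the coordinate permutations.** [cite: Balaban1987RG1, §1 p.263] -/
theorem plaqSmall_permute_iff (δ : ℝ) (π : Equiv.Perm (Fin P.d)) (U : GaugeField P j G) :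
    PlaqSmall δ (U.permute π) ↔ PlaqSmall δ U := by
  simp only [PlaqSmall, dist1_plaqHol_permute]
  exact (Plaq.permuteEquiv π).forall_congr (fun _ => Iff.rfl)

/-- The regular class is gauge invariant (the tree's `B12GaugeOrbits021.plaqSmall_gaugeAct_iff'`, here through §1).
[cite: Balaban1987RG1, (0.13) p.254] -/
theorem plaqSmall_gaugeAct_iff (δ : ℝ) (u : GaugeTransf P j G) (U : GaugeField P j G) :
    PlaqSmall δ (GaugeField.gaugeAct u U) ↔ PlaqSmall δ U := by
  simp only [PlaqSmall, apply_plaqHol_gaugeAct GaugeGroup.dist1_conj]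

/-- The restricted class `{|U(∂p) − 1| < δ, p ∈ S}` of a translated configuration is the class of the configuration
on the translated set of plaquettes. [cite: Balaban1988Convergent, (1.4) p.246] -/
theorem plaqSmallOn_translate_iff (S : Set (Plaq P j)) (δ : ℝ) (a : Site P j) (U : GaugeField P j G) :
    PlaqSmallOn S δ (U.translate a) ↔ PlaqSmallOn (Plaq.translate a '' S) δ U := by
  simp only [PlaqSmallOn, dist1_plaqHol_translate, Set.forall_mem_image]

/-- The same for the axis reflections. [cite: Balaban1988Convergent, (1.4) p.246] -/
theorem plaqSmallOn_reflect_iff (S : Set (Plaq P j)) (δ : ℝ) (μ : Fin P.d) (U : GaugeField P j G) :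
    PlaqSmallOn S δ (U.reflect μ) ↔ PlaqSmallOn (Plaq.reflect μ '' S) δ U := by
  simp only [PlaqSmallOn, apply_plaqHol_reflect GaugeGroup.dist1_inv GaugeGroup.dist1_conj, Set.forall_mem_image]

/-- The same for the coordinate permutations. [cite: Balaban1988Convergent, (1.4) p.246] -/
theorem plaqSmallOn_permute_iff (S : Set (Plaq P j)) (δ : ℝ) (π : Equiv.Perm (Fin P.d)) (U : GaugeField P j G) :
    PlaqSmallOn S δ (U.permute π) ↔ PlaqSmallOn (Plaq.permute π '' S) δ U := by
  simp only [PlaqSmallOn, dist1_plaqHol_permute, Set.forall_mem_image]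

/-- The same for the centre reflections. [cite: Balaban1988Convergent, (1.4) p.246] -/
theorem plaqSmallOn_creflect_iff (S : Set (Plaq P j)) (δ : ℝ) (ρ : Fin P.d) (U : GaugeField P j G) :
    PlaqSmallOn S δ (U.creflect ρ) ↔
      PlaqSmallOn ((fun p => (p.reflect ρ).translate ((0 : Site P j).unshift ρ)) '' S) δ U := by
  simp only [PlaqSmallOn, dist1_plaqHol_creflect, Set.forall_mem_image]

/-- On all plaquettes the restricted class is the class `PlaqSmall`. [cite: Balaban1988Convergent, (1.4) p.246] -/
theorem plaqSmallOn_univ_iff (δ : ℝ) (U : GaugeField P j G) : PlaqSmallOn Set.univ δ U ↔ PlaqSmall δ U := by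
  simp only [PlaqSmallOn, PlaqSmall, Set.mem_univ, forall_const]

/-- The characteristic function `χ` of (0.13)/(1.4) only sees the class: equivalent classes give equal `χ`.
[cite: Balaban1988Convergent, (1.4) p.246] -/
theorem chiSmall_congr_of_iff {j₁ j₂ : ℕ} {S₁ : Set (Plaq P j₁)} {S₂ : Set (Plaq P j₂)} {δ₁ δ₂ : ℝ}
    {U₁ : GaugeField P j₁ G} {U₂ : GaugeField P j₂ G} (h : PlaqSmallOn S₁ δ₁ U₁ ↔ PlaqSmallOn S₂ δ₂ U₂) :
    chiSmall S₁ δ₁ U₁ = chiSmall S₂ δ₂ U₂ := by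
  unfold chiSmall
  by_cases h₁ : PlaqSmallOn S₁ δ₁ U₁
  · rw [if_pos h₁, if_pos (h.1 h₁)]
  · rw [if_neg h₁, if_neg (fun h₂ => h₁ (h.2 h₂))]

/-- Conversely equal `χ` means equivalent classes (`χ` takes the values `1 ≠ 0`). [cite: Balaban1988Convergent, (1.4) p.246] -/
theorem plaqSmallOn_iff_of_chiSmall_eq {j₁ j₂ : ℕ} {S₁ : Set (Plaq P j₁)} {S₂ : Set (Plaq P j₂)} {δ₁ δ₂ : ℝ}
    {U₁ : GaugeField P j₁ G} {U₂ : GaugeField P j₂ G} (h : chiSmall S₁ δ₁ U₁ = chiSmall S₂ δ₂ U₂) :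
    PlaqSmallOn S₁ δ₁ U₁ ↔ PlaqSmallOn S₂ δ₂ U₂ := by
  unfold chiSmall at h
  by_cases h₁ : PlaqSmallOn S₁ δ₁ U₁ <;> by_cases h₂ : PlaqSmallOn S₂ δ₂ U₂
  · exact ⟨fun _ => h₂, fun _ => h₁⟩
  · rw [if_pos h₁, if_neg h₂] at h; exact absurd h one_ne_zero
  · rw [if_neg h₁, if_pos h₂] at h; exact absurd h.symm one_ne_zero
  · exact ⟨fun h' => absurd h' h₁, fun h' => absurd h' h₂⟩

/-- **The restriction factor `χ({|U(∂p) − 1| < δ, p ⊂ T})` of (0.13) is Euclidean invariant on every torus** (centre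
reflections as generators). [cite: Balaban1987RG1, (0.13) p.254] -/
theorem chiSmall_univ_euclInvariantC (δ : ℝ) :
    B12EuclClause263.EuclInvariantC (fun U : GaugeField P j G => chiSmall Set.univ δ U) := by
  refine ⟨fun a U => chiSmall_congr_of_iff ?_, fun ρ U => chiSmall_congr_of_iff ?_, fun π U => chiSmall_congr_of_iff ?_⟩
  · rw [plaqSmallOn_univ_iff, plaqSmallOn_univ_iff]; exact plaqSmall_translate_iff δ a U
  · rw [plaqSmallOn_univ_iff, plaqSmallOn_univ_iff]; exact plaqSmall_creflect_iff δ ρ U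
  · rw [plaqSmallOn_univ_iff, plaqSmallOn_univ_iff]; exact plaqSmall_permute_iff δ π U

/-- The same in the axis-reflection convention of `B12SmallFieldDomain259.EuclInvariant`. [cite: Balaban1987RG1, (0.13) p.254] -/
theorem chiSmall_univ_euclInvariant (δ : ℝ) :
    B12SmallFieldDomain259.EuclInvariant (fun U : GaugeField P j G => chiSmall Set.univ δ U) :=
  (B12EuclClause263.euclInvariantC_iff_euclInvariant _).1 (chiSmall_univ_euclInvariantC δ)

/-- On `T_η` the restriction factor is invariant under the transformations preserving every `T⁽ʲ⁾`.
[cite: Balaban1987RG1, §1 p.263] -/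
theorem chiSmall_univ_nestedInvariant (δ : ℝ) (j' : ℕ) :
    B12EuclClause263.NestedInvariant j' (fun U : GaugeField P 0 G => chiSmall Set.univ δ U) :=
  ((B12EuclClause263.nestedInvariant_zero_iff_euclInvariantC _).2 (chiSmall_univ_euclInvariantC δ)).of_le
    (Nat.zero_le j')

/-- The restriction factor is gauge invariant. [cite: Balaban1987RG1, (0.13) p.254] -/
theorem chiSmall_univ_gaugeInvariant (δ : ℝ) :
    GaugeField.GaugeInvariant (fun U : GaugeField P j G => chiSmall Set.univ δ U) := by
  intro u U
  refine chiSmall_congr_of_iff ?_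
  rw [plaqSmallOn_univ_iff, plaqSmallOn_univ_iff]
  exact plaqSmall_gaugeAct_iff δ u U

/-- **The alternative small-field domain of p. 259 `{V : |∂V − 1| < ε₀ on T₁⁽ᵏ⁾}` is invariant under the
transformations of `T⁽ᵏ⁾`.** [cite: Balaban1987RG1, Thm 1 p.259] -/
theorem smallFieldDomAlt_invariant (ε₀ : ℝ) (k : ℕ) (V : GaugeField P k G) :
    (∀ a : Site P k, V.translate a ∈ B12SmallFieldDomain259.smallFieldDomAlt P G ε₀ k ↔
        V ∈ B12SmallFieldDomain259.smallFieldDomAlt P G ε₀ k) ∧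
    (∀ ρ : Fin P.d, V.creflect ρ ∈ B12SmallFieldDomain259.smallFieldDomAlt P G ε₀ k ↔
        V ∈ B12SmallFieldDomain259.smallFieldDomAlt P G ε₀ k) ∧
    (∀ μ : Fin P.d, V.reflect μ ∈ B12SmallFieldDomain259.smallFieldDomAlt P G ε₀ k ↔
        V ∈ B12SmallFieldDomain259.smallFieldDomAlt P G ε₀ k) ∧
    (∀ π : Equiv.Perm (Fin P.d), V.permute π ∈ B12SmallFieldDomain259.smallFieldDomAlt P G ε₀ k ↔
        V ∈ B12SmallFieldDomain259.smallFieldDomAlt P G ε₀ k) :=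
  ⟨fun a => plaqSmall_translate_iff ε₀ a V, fun ρ => plaqSmall_creflect_iff ε₀ ρ V,
    fun μ => plaqSmall_reflect_iff ε₀ μ V, fun π => plaqSmall_permute_iff ε₀ π V⟩

end Regular

/-! ## §3. The class/domain hypotheses of `B12EuclClause263.action_comp_background_invariant` discharged -/

section Discharge

open B12EuclClause263

variable {P : Params} {G : Type*} [GaugeGroup G] {av : ∀ j, Averaging P j G}

/-- A `PlaqSmall` level set on `T_η` is stable under the translations by `L^k a`, the centre reflections and the
permutations — the shape of `hregT/hregC/hregP`. [cite: Balaban1987RG1, (0.21) p.256] -/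
theorem reg_hyps_of_plaqSmall {reg : Set (GaugeField P 0 G)} {ε : ℝ} (hreg : reg = {U | PlaqSmall ε U}) (k : ℕ) :
    (∀ (a : Site P k) (U : GaugeField P 0 G), U ∈ reg → U.translate (Site.scaleTo k a) ∈ reg) ∧
    (∀ (ρ : Fin P.d) (U : GaugeField P 0 G), U ∈ reg → U.creflect ρ ∈ reg) ∧
    (∀ (π : Equiv.Perm (Fin P.d)) (U : GaugeField P 0 G), U ∈ reg → U.permute π ∈ reg) := by
  subst hreg
  exact ⟨fun a U hU => (plaqSmall_translate_iff ε _ U).2 hU, fun ρ U hU => (plaqSmall_creflect_iff ε ρ U).2 hU,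
    fun π U hU => (plaqSmall_permute_iff ε π U).2 hU⟩

/-- A `PlaqSmall` level set on `T⁽ᵏ⁾` is stable under the transformations of `T⁽ᵏ⁾` — the shape of
`hdomT/hdomC/hdomP`. [cite: Balaban1987RG1, (1.2) p.260] -/
theorem dom_hyps_of_plaqSmall {k : ℕ} {dom : Set (GaugeField P k G)} {δ : ℝ} (hdom : dom = {V | PlaqSmall δ V}) :
    (∀ (a : Site P k) (V : GaugeField P k G), V ∈ dom → V.translate a ∈ dom) ∧
    (∀ (ρ : Fin P.d) (V : GaugeField P k G), V ∈ dom → V.creflect ρ ∈ dom) ∧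
    (∀ (π : Equiv.Perm (Fin P.d)) (V : GaugeField P k G), V ∈ dom → V.permute π ∈ dom) := by
  subst hdom
  exact ⟨fun a V hV => (plaqSmall_translate_iff δ a V).2 hV, fun ρ V hV => (plaqSmall_creflect_iff δ ρ V).2 hV,
    fun π V hV => (plaqSmall_permute_iff δ π V).2 hV⟩

/-- **THE FIRST SENTENCE OF p. 263 FOR `A_k(V) = A_k(U_k(V))` WITH THE PRINTED REGULAR CLASS AND DOMAIN**: for
background data whose regular class is `{U : |U(∂p) − 1| < ε on T_η}` ((0.21), p. 254) and whose level-`k` domain is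
`{V : |V(∂p) − 1| < δ on T⁽ᵏ⁾}` ((1.1)–(1.2)), with nested-covariant averagings and the minimiser unique modulo gauge
([15] Thm 1), every gauge-invariant `A_k` invariant under the transformations of `T_η` preserving `T⁽ᵏ⁾` gives a
`V ↦ A_k(U_k(V))` invariant under the translations, centre reflections and coordinate permutations of `T⁽ᵏ⁾` — the six
class/domain hypotheses of `B12EuclClause263.action_comp_background_invariant` discharged by § 2.
[cite: Balaban1987RG1, §1 p.263] -/
theorem action_comp_background_invariant_plaqSmall (bg : Background P G av) (k : ℕ) {ε δ : ℝ}
    (hreg : bg.reg = {U | PlaqSmall ε U}) (hdom : bg.dom k = {V | PlaqSmall δ V})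
    (hav : AveragingNestedCovariant av) (huniq : UniqueModGauge av bg.reg k (bg.dom k) (bg.U k))
    {Ak : GaugeField P 0 G → ℝ} (hAg : GaugeField.GaugeInvariant Ak) (hAn : NestedInvariant k Ak)
    {V : GaugeField P k G} (hV : V ∈ bg.dom k) :
    (∀ a : Site P k, Ak (bg.U k (V.translate a)) = Ak (bg.U k V)) ∧
    (∀ ρ : Fin P.d, Ak (bg.U k (V.creflect ρ)) = Ak (bg.U k V)) ∧
    (∀ π : Equiv.Perm (Fin P.d), Ak (bg.U k (V.permute π)) = Ak (bg.U k V)) :=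
  have hr := reg_hyps_of_plaqSmall hreg k
  have hd := dom_hyps_of_plaqSmall hdom
  action_comp_background_invariant bg k hd.1 hd.2.1 hd.2.2 hr.1 hr.2.1 hr.2.2 hav huniq hAg hAn hV

/-- The same when the domain is all of `T⁽ᵏ⁾`-configurations: `V ↦ A_k(U_k(V))` is `EuclInvariantC`.
[cite: Balaban1987RG1, §1 p.263] -/
theorem euclInvariantC_comp_background_plaqSmall (bg : Background P G av) (k : ℕ) {ε : ℝ}
    (hreg : bg.reg = {U | PlaqSmall ε U}) (hdom : bg.dom k = Set.univ)
    (hav : AveragingNestedCovariant av) (huniq : UniqueModGauge av bg.reg k (bg.dom k) (bg.U k))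
    {Ak : GaugeField P 0 G → ℝ} (hAg : GaugeField.GaugeInvariant Ak) (hAn : NestedInvariant k Ak) :
    EuclInvariantC (fun V => Ak (bg.U k V)) :=
  have hr := reg_hyps_of_plaqSmall hreg k
  euclInvariantC_comp_background bg k hdom hr.1 hr.2.1 hr.2.2 hav huniq hAg hAn

/-- Hence, in the gen-1 vocabulary, `B12SmallFieldDomain259.ActionEuclInvariant bg Ak k` for such data.
[cite: Balaban1987RG1, §1 p.263] -/
theorem actionEuclInvariant_plaqSmall (bg : Background P G av) (k : ℕ) {ε : ℝ}
    (hreg : bg.reg = {U | PlaqSmall ε U}) (hdom : bg.dom k = Set.univ)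
    (hav : AveragingNestedCovariant av) (huniq : UniqueModGauge av bg.reg k (bg.dom k) (bg.U k))
    {Ak : GaugeField P 0 G → ℝ} (hAg : GaugeField.GaugeInvariant Ak) (hAn : NestedInvariant k Ak) :
    B12SmallFieldDomain259.ActionEuclInvariant bg Ak k :=
  (euclInvariantC_iff_euclInvariant _).1 (euclInvariantC_comp_background_plaqSmall bg k hreg hdom hav huniq hAg hAn)

end Discharge

/-! ## §4. The small-field domain of Theorem 1 (p. 259) is invariant under the transformations of `T⁽ᵏ⁾` -/

section SmallFieldDomain

open B12EuclClause263 B12SmallFieldDomain259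

variable {P : Params} {G : Type*} [GaugeGroup G] {av : ∀ j, Averaging P j G}

/-- **The minimiser of the transformed `V` is the transformed minimiser up to gauge**, so every gauge-invariant,
nested-invariant predicate of `U_k(V)` — here `|∂U_k(V) − 1| < δ′ on T_η` — takes the same value at `V` and at its
translates. [cite: Balaban1987RG1, Thm 1 p.259] -/
theorem plaqSmall_background_translate_iff (bg : Background P G av) (k : ℕ) {ε δ : ℝ}
    (hreg : bg.reg = {U | PlaqSmall ε U}) (hdom : bg.dom k = {V | PlaqSmall δ V})
    (hav : AveragingNestedCovariant av) (huniq : UniqueModGauge av bg.reg k (bg.dom k) (bg.U k))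
    (δ' : ℝ) {V : GaugeField P k G} (hV : V ∈ bg.dom k) (a : Site P k) :
    PlaqSmall δ' (bg.U k (V.translate a)) ↔ PlaqSmall δ' (bg.U k V) := by
  have h := (action_comp_background_invariant_plaqSmall bg k hreg hdom hav huniq
    (chiSmall_univ_gaugeInvariant δ') (chiSmall_univ_nestedInvariant δ' k) hV).1 a
  rw [← plaqSmallOn_univ_iff, ← plaqSmallOn_univ_iff]
  exact plaqSmallOn_iff_of_chiSmall_eq h

/-- The same for the centre reflections. [cite: Balaban1987RG1, Thm 1 p.259] -/
theorem plaqSmall_background_creflect_iff (bg : Background P G av) (k : ℕ) {ε δ : ℝ}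
    (hreg : bg.reg = {U | PlaqSmall ε U}) (hdom : bg.dom k = {V | PlaqSmall δ V})
    (hav : AveragingNestedCovariant av) (huniq : UniqueModGauge av bg.reg k (bg.dom k) (bg.U k))
    (δ' : ℝ) {V : GaugeField P k G} (hV : V ∈ bg.dom k) (ρ : Fin P.d) :
    PlaqSmall δ' (bg.U k (V.creflect ρ)) ↔ PlaqSmall δ' (bg.U k V) := by
  have h := (action_comp_background_invariant_plaqSmall bg k hreg hdom hav huniq
    (chiSmall_univ_gaugeInvariant δ') (chiSmall_univ_nestedInvariant δ' k) hV).2.1 ρ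
  rw [← plaqSmallOn_univ_iff, ← plaqSmallOn_univ_iff]
  exact plaqSmallOn_iff_of_chiSmall_eq h

/-- The same for the coordinate permutations. [cite: Balaban1987RG1, Thm 1 p.259] -/
theorem plaqSmall_background_permute_iff (bg : Background P G av) (k : ℕ) {ε δ : ℝ}
    (hreg : bg.reg = {U | PlaqSmall ε U}) (hdom : bg.dom k = {V | PlaqSmall δ V})
    (hav : AveragingNestedCovariant av) (huniq : UniqueModGauge av bg.reg k (bg.dom k) (bg.U k))
    (δ' : ℝ) {V : GaugeField P k G} (hV : V ∈ bg.dom k) (π : Equiv.Perm (Fin P.d)) :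
    PlaqSmall δ' (bg.U k (V.permute π)) ↔ PlaqSmall δ' (bg.U k V) := by
  have h := (action_comp_background_invariant_plaqSmall bg k hreg hdom hav huniq
    (chiSmall_univ_gaugeInvariant δ') (chiSmall_univ_nestedInvariant δ' k) hV).2.2 π
  rw [← plaqSmallOn_univ_iff, ← plaqSmallOn_univ_iff]
  exact plaqSmallOn_iff_of_chiSmall_eq h

/-- **THE SMALL-FIELD DOMAIN OF THEOREM 1 IS INVARIANT UNDER THE TRANSFORMATIONS OF `T⁽ᵏ⁾`** (p. 259: the regular `V`
*«such that the configuration U_k(V) … satisfies the small field condition |∂U_k(V) − 1| < ε₀η² on T_η»*), for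
background data with the printed regular class and domain, nested-covariant averagings and the minimal orbit unique
modulo gauge ([15] Thm 1): translations. [cite: Balaban1987RG1, Thm 1 p.259] -/
theorem smallFieldDom_translate_iff (bg : Background P G av) (k : ℕ) {ε δ : ℝ}
    (hreg : bg.reg = {U | PlaqSmall ε U}) (hdom : bg.dom k = {V | PlaqSmall δ V})
    (hav : AveragingNestedCovariant av) (huniq : UniqueModGauge av bg.reg k (bg.dom k) (bg.U k))
    (ε₀ : ℝ) (V : GaugeField P k G) (a : Site P k) :
    V.translate a ∈ smallFieldDom bg ε₀ k ↔ V ∈ smallFieldDom bg ε₀ k := by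
  simp only [mem_smallFieldDom]
  have hd : V.translate a ∈ bg.dom k ↔ V ∈ bg.dom k := by
    rw [hdom]; exact plaqSmall_translate_iff δ a V
  constructor
  · rintro ⟨h1, h2⟩
    have hV := hd.1 h1
    exact ⟨hV, (plaqSmall_background_translate_iff bg k hreg hdom hav huniq _ hV a).1 h2⟩
  · rintro ⟨h1, h2⟩
    exact ⟨hd.2 h1, (plaqSmall_background_translate_iff bg k hreg hdom hav huniq _ h1 a).2 h2⟩

/-- The small-field domain of Theorem 1 is invariant: centre reflections. [cite: Balaban1987RG1, Thm 1 p.259] -/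
theorem smallFieldDom_creflect_iff (bg : Background P G av) (k : ℕ) {ε δ : ℝ}
    (hreg : bg.reg = {U | PlaqSmall ε U}) (hdom : bg.dom k = {V | PlaqSmall δ V})
    (hav : AveragingNestedCovariant av) (huniq : UniqueModGauge av bg.reg k (bg.dom k) (bg.U k))
    (ε₀ : ℝ) (V : GaugeField P k G) (ρ : Fin P.d) :
    V.creflect ρ ∈ smallFieldDom bg ε₀ k ↔ V ∈ smallFieldDom bg ε₀ k := by
  simp only [mem_smallFieldDom]
  have hd : V.creflect ρ ∈ bg.dom k ↔ V ∈ bg.dom k := by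
    rw [hdom]; exact plaqSmall_creflect_iff δ ρ V
  constructor
  · rintro ⟨h1, h2⟩
    have hV := hd.1 h1
    exact ⟨hV, (plaqSmall_background_creflect_iff bg k hreg hdom hav huniq _ hV ρ).1 h2⟩
  · rintro ⟨h1, h2⟩
    exact ⟨hd.2 h1, (plaqSmall_background_creflect_iff bg k hreg hdom hav huniq _ h1 ρ).2 h2⟩

/-- The small-field domain of Theorem 1 is invariant: coordinate permutations. [cite: Balaban1987RG1, Thm 1 p.259] -/
theorem smallFieldDom_permute_iff (bg : Background P G av) (k : ℕ) {ε δ : ℝ}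
    (hreg : bg.reg = {U | PlaqSmall ε U}) (hdom : bg.dom k = {V | PlaqSmall δ V})
    (hav : AveragingNestedCovariant av) (huniq : UniqueModGauge av bg.reg k (bg.dom k) (bg.U k))
    (ε₀ : ℝ) (V : GaugeField P k G) (π : Equiv.Perm (Fin P.d)) :
    V.permute π ∈ smallFieldDom bg ε₀ k ↔ V ∈ smallFieldDom bg ε₀ k := by
  simp only [mem_smallFieldDom]
  have hd : V.permute π ∈ bg.dom k ↔ V ∈ bg.dom k := by
    rw [hdom]; exact plaqSmall_permute_iff δ π V
  constructor
  · rintro ⟨h1, h2⟩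
    have hV := hd.1 h1
    exact ⟨hV, (plaqSmall_background_permute_iff bg k hreg hdom hav huniq _ hV π).1 h2⟩
  · rintro ⟨h1, h2⟩
    exact ⟨hd.2 h1, (plaqSmall_background_permute_iff bg k hreg hdom hav huniq _ h1 π).2 h2⟩

/-- **`A_k` restricted to the small-field domain** (the object Theorem 1 speaks about): on the small-field domain
`V ↦ A_k(U_k(V))` takes the same value at `V` and at each of its transforms, which again lie in the domain.
[cite: Balaban1987RG1, Thm 1 p.259] -/
theorem action_invariant_on_smallFieldDom (bg : Background P G av) (k : ℕ) {ε δ : ℝ}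
    (hreg : bg.reg = {U | PlaqSmall ε U}) (hdom : bg.dom k = {V | PlaqSmall δ V})
    (hav : AveragingNestedCovariant av) (huniq : UniqueModGauge av bg.reg k (bg.dom k) (bg.U k))
    {Ak : GaugeField P 0 G → ℝ} (hAg : GaugeField.GaugeInvariant Ak) (hAn : NestedInvariant k Ak)
    (ε₀ : ℝ) {V : GaugeField P k G} (hV : V ∈ smallFieldDom bg ε₀ k) :
    (∀ a : Site P k, V.translate a ∈ smallFieldDom bg ε₀ k ∧ Ak (bg.U k (V.translate a)) = Ak (bg.U k V)) ∧
    (∀ ρ : Fin P.d, V.creflect ρ ∈ smallFieldDom bg ε₀ k ∧ Ak (bg.U k (V.creflect ρ)) = Ak (bg.U k V)) ∧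
    (∀ π : Equiv.Perm (Fin P.d), V.permute π ∈ smallFieldDom bg ε₀ k ∧ Ak (bg.U k (V.permute π)) = Ak (bg.U k V)) := by
  have hAk := action_comp_background_invariant_plaqSmall bg k hreg hdom hav huniq hAg hAn hV.1
  exact ⟨fun a => ⟨(smallFieldDom_translate_iff bg k hreg hdom hav huniq ε₀ V a).2 hV, hAk.1 a⟩,
    fun ρ => ⟨(smallFieldDom_creflect_iff bg k hreg hdom hav huniq ε₀ V ρ).2 hV, hAk.2.1 ρ⟩,
    fun π => ⟨(smallFieldDom_permute_iff bg k hreg hdom hav huniq ε₀ V π).2 hV, hAk.2.2 π⟩⟩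

end SmallFieldDomain

/-! ## §5. (v1.1) [I]'s two-level average (0.12) is nested-covariant: the hypothesis `hav` discharged -/

section TwoLevel

open B12EuclClause263 B12SmallFieldDomain259 BlockAveragingTwoLevel

variable {P : Params} {G : Type*} [GaugeGroup G]

/-- **THE (0.12)-SHAPE TWO-LEVEL BLOCK AVERAGING IS NESTED-COVARIANT**: for every axiomatic group average `M`
((0.5)–(0.7)) and small-loop average `ℰ`, each step `U ↦ Ū` of `BlockAveragingTwoLevel.blockAvg₂ M ℰ` intertwines the
translations by `L·a`, the centre reflections and the coordinate permutations (the tree's `blockAvg₂_translate`,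
`blockAvg₂_creflect`, `blockAvg₂_permute`) — p. 252: the definition of [12] «is not symmetric with respect to lattice
Euclidean transformations», the present one is. [cite: Balaban1987RG1, (0.12) p.254] -/
theorem blockAvg₂_nestedCovariant (𝓜 : GroupAverage G) (ℰ : LoopAverage G) :
    AveragingNestedCovariant (fun j => (blockAvg₂ 𝓜 ℰ : Averaging P j G)) :=
  ⟨fun _ a U => blockAvg₂_translate 𝓜 ℰ a U, fun _ ρ U => blockAvg₂_creflect 𝓜 ℰ ρ U,
    fun _ π U => blockAvg₂_permute 𝓜 ℰ π U⟩

variable (𝓜 : GroupAverage G) (ℰ : LoopAverage G)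

/-- **Translations carry constrained minimisers to constrained minimisers** for [I]'s data — the (0.12) average and
the regular class `{U : |U(∂p) − 1| < ε}` — with NO uniqueness input: if `U₀` minimises `A` over
`{Ū^k = V} ∩ reg`, then `τ_{L^k a}U₀` minimises it over `{Ū^k = τ_a V} ∩ reg`. [cite: Balaban1987RG1, (0.21) p.256] -/
theorem isBackground_blockAvg₂_translate {ε : ℝ} {k : ℕ} {V : GaugeField P k G} {U₀ : GaugeField P 0 G}
    (h : IsBackground (fun j => (blockAvg₂ 𝓜 ℰ : Averaging P j G)) {U | PlaqSmall ε U} k V U₀) (a : Site P k) :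
    IsBackground (fun j => (blockAvg₂ 𝓜 ℰ : Averaging P j G)) {U | PlaqSmall ε U} k (V.translate a)
      (U₀.translate (Site.scaleTo k a)) :=
  IsBackground.translate (blockAvg₂_nestedCovariant 𝓜 ℰ) (reg_hyps_of_plaqSmall rfl k).1 h a

/-- The same for the centre reflections. [cite: Balaban1987RG1, (0.21) p.256] -/
theorem isBackground_blockAvg₂_creflect {ε : ℝ} {k : ℕ} {V : GaugeField P k G} {U₀ : GaugeField P 0 G}
    (h : IsBackground (fun j => (blockAvg₂ 𝓜 ℰ : Averaging P j G)) {U | PlaqSmall ε U} k V U₀) (ρ : Fin P.d) :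
    IsBackground (fun j => (blockAvg₂ 𝓜 ℰ : Averaging P j G)) {U | PlaqSmall ε U} k (V.creflect ρ)
      (U₀.creflect ρ) :=
  IsBackground.creflect (blockAvg₂_nestedCovariant 𝓜 ℰ) (reg_hyps_of_plaqSmall rfl k).2.1 h ρ

/-- The same for the coordinate permutations. [cite: Balaban1987RG1, (0.21) p.256] -/
theorem isBackground_blockAvg₂_permute {ε : ℝ} {k : ℕ} {V : GaugeField P k G} {U₀ : GaugeField P 0 G}
    (h : IsBackground (fun j => (blockAvg₂ 𝓜 ℰ : Averaging P j G)) {U | PlaqSmall ε U} k V U₀)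
    (π : Equiv.Perm (Fin P.d)) :
    IsBackground (fun j => (blockAvg₂ 𝓜 ℰ : Averaging P j G)) {U | PlaqSmall ε U} k (V.permute π)
      (U₀.permute π) :=
  IsBackground.permute (blockAvg₂_nestedCovariant 𝓜 ℰ) (reg_hyps_of_plaqSmall rfl k).2.2 h π

/-- **THE FIRST SENTENCE OF p. 263 FOR `A_k(V) = A_k(U_k(V))` WITH THE PRINTED AVERAGE, REGULAR CLASS AND DOMAIN**:
background data over the (0.12) average whose regular class is `{|U(∂p) − 1| < ε}` and whose level-`k` domain is
`{|V(∂p) − 1| < δ}`, with the minimiser unique modulo gauge ([15] Thm 1): every gauge-invariant `A_k` invariant under the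
transformations of `T_η` preserving `T⁽ᵏ⁾` gives a `V ↦ A_k(U_k(V))` invariant under the translations, centre reflections
and permutations of `T⁽ᵏ⁾` at every `V` of the domain. [cite: Balaban1987RG1, §1 p.263] -/
theorem action_comp_background_invariant_blockAvg₂
    (bg : Background P G (fun j => (blockAvg₂ 𝓜 ℰ : Averaging P j G))) (k : ℕ) {ε δ : ℝ}
    (hreg : bg.reg = {U | PlaqSmall ε U}) (hdom : bg.dom k = {V | PlaqSmall δ V})
    (huniq : UniqueModGauge (fun j => (blockAvg₂ 𝓜 ℰ : Averaging P j G)) bg.reg k (bg.dom k) (bg.U k))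
    {Ak : GaugeField P 0 G → ℝ} (hAg : GaugeField.GaugeInvariant Ak) (hAn : NestedInvariant k Ak)
    {V : GaugeField P k G} (hV : V ∈ bg.dom k) :
    (∀ a : Site P k, Ak (bg.U k (V.translate a)) = Ak (bg.U k V)) ∧
    (∀ ρ : Fin P.d, Ak (bg.U k (V.creflect ρ)) = Ak (bg.U k V)) ∧
    (∀ π : Equiv.Perm (Fin P.d), Ak (bg.U k (V.permute π)) = Ak (bg.U k V)) :=
  action_comp_background_invariant_plaqSmall bg k hreg hdom (blockAvg₂_nestedCovariant 𝓜 ℰ) huniq hAg hAn hV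

/-- **THE SMALL-FIELD DOMAIN OF THEOREM 1 FOR THE PRINTED AVERAGE** is invariant under the transformations of `T⁽ᵏ⁾`
(regular class and domain `PlaqSmall` level sets, minimiser unique modulo gauge). [cite: Balaban1987RG1, Thm 1 p.259] -/
theorem smallFieldDom_blockAvg₂_invariant
    (bg : Background P G (fun j => (blockAvg₂ 𝓜 ℰ : Averaging P j G))) (k : ℕ) {ε δ : ℝ}
    (hreg : bg.reg = {U | PlaqSmall ε U}) (hdom : bg.dom k = {V | PlaqSmall δ V})
    (huniq : UniqueModGauge (fun j => (blockAvg₂ 𝓜 ℰ : Averaging P j G)) bg.reg k (bg.dom k) (bg.U k))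
    (ε₀ : ℝ) (V : GaugeField P k G) :
    (∀ a : Site P k, V.translate a ∈ smallFieldDom bg ε₀ k ↔ V ∈ smallFieldDom bg ε₀ k) ∧
    (∀ ρ : Fin P.d, V.creflect ρ ∈ smallFieldDom bg ε₀ k ↔ V ∈ smallFieldDom bg ε₀ k) ∧
    (∀ π : Equiv.Perm (Fin P.d), V.permute π ∈ smallFieldDom bg ε₀ k ↔ V ∈ smallFieldDom bg ε₀ k) :=
  ⟨fun a => smallFieldDom_translate_iff bg k hreg hdom (blockAvg₂_nestedCovariant 𝓜 ℰ) huniq ε₀ V a,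
    fun ρ => smallFieldDom_creflect_iff bg k hreg hdom (blockAvg₂_nestedCovariant 𝓜 ℰ) huniq ε₀ V ρ,
    fun π => smallFieldDom_permute_iff bg k hreg hdom (blockAvg₂_nestedCovariant 𝓜 ℰ) huniq ε₀ V π⟩

/-- **BOTH SENTENCES OF p. 263 ASSEMBLED FOR THE ACTION (1.3) OF THE TOWER AND THE PRINTED DATA**: for a small-field
tower `T` satisfying the inductive hypotheses `SFHyp T c k` ((1.18)/(1.19)), the p. 263 clause on its terms
(`EuclClause263 T k`), the intertwining of the substitution (1.9) with the gauge action (1.10) (`ι`, `hι`) and the gauge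
invariance of the explicit `log Z⁽ʲ⁾`, `j < k` («easily verifiable … for all explicitly defined terms»), and for background
data over the (0.12) average with the printed regular class and domain and the minimal orbit unique modulo gauge
([15] Thm 1): `V ↦ A_k(U_k(V))` (form (1.3)) is invariant under the transformations of `T⁽ᵏ⁾` at every `V` of the
domain — «Thus the action A_k is invariant with respect to transformations of the lattice T⁽ᵏ⁾».
[cite: Balaban1987RG1, §1 p.263] -/
theorem action13_comp_background_invariant_blockAvg₂ {Φ 𝒢 : Type*} (T : Step.SFTower P G Φ 𝒢)
    {c : Step.SFConsts} {k : ℕ} (hT : Step.SFHyp T c k) (hE : EuclClause263 T k)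
    (ι : GaugeTransf P 0 G → 𝒢) (hι : ∀ u U, T.ofBackground (GaugeField.gaugeAct u U) = T.act (ι u) (T.ofBackground U))
    (hZ : ∀ j, j < k → ∀ (u : GaugeTransf P 0 G) (U : GaugeField P 0 G), T.logZ j (GaugeField.gaugeAct u U) = T.logZ j U)
    (bg : Background P G (fun j => (blockAvg₂ 𝓜 ℰ : Averaging P j G))) {ε δ : ℝ}
    (hreg : bg.reg = {U | PlaqSmall ε U}) (hdom : bg.dom k = {V | PlaqSmall δ V})
    (huniq : UniqueModGauge (fun j => (blockAvg₂ 𝓜 ℰ : Averaging P j G)) bg.reg k (bg.dom k) (bg.U k))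
    {V : GaugeField P k G} (hV : V ∈ bg.dom k) :
    (∀ a : Site P k, T.action13 k (bg.U k (V.translate a)) = T.action13 k (bg.U k V)) ∧
    (∀ ρ : Fin P.d, T.action13 k (bg.U k (V.creflect ρ)) = T.action13 k (bg.U k V)) ∧
    (∀ π : Equiv.Perm (Fin P.d), T.action13 k (bg.U k (V.permute π)) = T.action13 k (bg.U k V)) :=
  action_comp_background_invariant_blockAvg₂ 𝓜 ℰ bg k hreg hdom huniq
    (B12GaugeOrbits021.gaugeInvariant_action13 T hT ι hι hZ) (action13_nestedInvariant T hE) hV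

end TwoLevel

/-! ## §6. (v1.2) The same for the one-level average (0.4) and for the axial averaging -/

section OneLevelAverage

open B12EuclClause263 B12SmallFieldDomain259 BlockAveraging

variable {P : Params} {G : Type*} [GaugeGroup G]

/-- **THE SYMMETRIC ONE-LEVEL BLOCK AVERAGING (0.4) IS NESTED-COVARIANT** (every small-loop average `ℰ`; the tree's
`BlockAveraging.blockAvg_translate/creflect/permute`) — p. 254 «both definitions are equally good for our purposes».
[cite: Balaban1987RG1, (0.4) p.253] -/
theorem blockAvg_nestedCovariant (ℰ : LoopAverage G) :
    AveragingNestedCovariant (fun j => (blockAvg ℰ : Averaging P j G)) :=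
  ⟨fun _ a U => blockAvg_translate ℰ a U, fun _ ρ U => blockAvg_creflect ℰ ρ U, fun _ π U => blockAvg_permute ℰ π U⟩

variable (ℰ : LoopAverage G)

/-- The first sentence of p. 263 for `A_k(V) = A_k(U_k(V))` with the (0.4) average, the printed regular class and domain,
modulo [15] Thm 1 (`UniqueModGauge`) and the two invariances of `A_k`. [cite: Balaban1987RG1, §1 p.263] -/
theorem action_comp_background_invariant_blockAvg
    (bg : Background P G (fun j => (blockAvg ℰ : Averaging P j G))) (k : ℕ) {ε δ : ℝ}
    (hreg : bg.reg = {U | PlaqSmall ε U}) (hdom : bg.dom k = {V | PlaqSmall δ V})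
    (huniq : UniqueModGauge (fun j => (blockAvg ℰ : Averaging P j G)) bg.reg k (bg.dom k) (bg.U k))
    {Ak : GaugeField P 0 G → ℝ} (hAg : GaugeField.GaugeInvariant Ak) (hAn : NestedInvariant k Ak)
    {V : GaugeField P k G} (hV : V ∈ bg.dom k) :
    (∀ a : Site P k, Ak (bg.U k (V.translate a)) = Ak (bg.U k V)) ∧
    (∀ ρ : Fin P.d, Ak (bg.U k (V.creflect ρ)) = Ak (bg.U k V)) ∧
    (∀ π : Equiv.Perm (Fin P.d), Ak (bg.U k (V.permute π)) = Ak (bg.U k V)) :=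
  action_comp_background_invariant_plaqSmall bg k hreg hdom (blockAvg_nestedCovariant ℰ) huniq hAg hAn hV

/-- Both sentences of p. 263 assembled for the tower's (1.3) with the (0.4) average (inputs as in
`action13_comp_background_invariant_blockAvg₂`). [cite: Balaban1987RG1, §1 p.263] -/
theorem action13_comp_background_invariant_blockAvg {Φ 𝒢 : Type*} (T : Step.SFTower P G Φ 𝒢)
    {c : Step.SFConsts} {k : ℕ} (hT : Step.SFHyp T c k) (hE : EuclClause263 T k)
    (ι : GaugeTransf P 0 G → 𝒢) (hι : ∀ u U, T.ofBackground (GaugeField.gaugeAct u U) = T.act (ι u) (T.ofBackground U))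
    (hZ : ∀ j, j < k → ∀ (u : GaugeTransf P 0 G) (U : GaugeField P 0 G), T.logZ j (GaugeField.gaugeAct u U) = T.logZ j U)
    (bg : Background P G (fun j => (blockAvg ℰ : Averaging P j G))) {ε δ : ℝ}
    (hreg : bg.reg = {U | PlaqSmall ε U}) (hdom : bg.dom k = {V | PlaqSmall δ V})
    (huniq : UniqueModGauge (fun j => (blockAvg ℰ : Averaging P j G)) bg.reg k (bg.dom k) (bg.U k))
    {V : GaugeField P k G} (hV : V ∈ bg.dom k) :
    (∀ a : Site P k, T.action13 k (bg.U k (V.translate a)) = T.action13 k (bg.U k V)) ∧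
    (∀ ρ : Fin P.d, T.action13 k (bg.U k (V.creflect ρ)) = T.action13 k (bg.U k V)) ∧
    (∀ π : Equiv.Perm (Fin P.d), T.action13 k (bg.U k (V.permute π)) = T.action13 k (bg.U k V)) :=
  action_comp_background_invariant_blockAvg ℰ bg k hreg hdom huniq
    (B12GaugeOrbits021.gaugeInvariant_action13 T hT ι hι hZ) (action13_nestedInvariant T hE) hV

/-- Both sentences of p. 263 assembled for the tower's (1.3) with the AXIAL (decimation) averaging of `AveragingRT` — the
block axial gauge of [9, 16] p. 254 — nested-covariant by `B12EuclClause263.axial_nestedCovariant'`.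
[cite: Balaban1987RG1, §1 p.263] -/
theorem action13_comp_background_invariant_axial {Φ 𝒢 : Type*} (T : Step.SFTower P G Φ 𝒢)
    {c : Step.SFConsts} {k : ℕ} (hT : Step.SFHyp T c k) (hE : EuclClause263 T k)
    (ι : GaugeTransf P 0 G → 𝒢) (hι : ∀ u U, T.ofBackground (GaugeField.gaugeAct u U) = T.act (ι u) (T.ofBackground U))
    (hZ : ∀ j, j < k → ∀ (u : GaugeTransf P 0 G) (U : GaugeField P 0 G), T.logZ j (GaugeField.gaugeAct u U) = T.logZ j U)
    (bg : Background P G (fun j => (AveragingRT.axial : Averaging P j G))) {ε δ : ℝ}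
    (hreg : bg.reg = {U | PlaqSmall ε U}) (hdom : bg.dom k = {V | PlaqSmall δ V})
    (huniq : UniqueModGauge (fun j => (AveragingRT.axial : Averaging P j G)) bg.reg k (bg.dom k) (bg.U k))
    {V : GaugeField P k G} (hV : V ∈ bg.dom k) :
    (∀ a : Site P k, T.action13 k (bg.U k (V.translate a)) = T.action13 k (bg.U k V)) ∧
    (∀ ρ : Fin P.d, T.action13 k (bg.U k (V.creflect ρ)) = T.action13 k (bg.U k V)) ∧
    (∀ π : Equiv.Perm (Fin P.d), T.action13 k (bg.U k (V.permute π)) = T.action13 k (bg.U k V)) :=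
  action_comp_background_invariant_plaqSmall bg k hreg hdom axial_nestedCovariant' huniq
    (B12GaugeOrbits021.gaugeInvariant_action13 T hT ι hι hZ) (action13_nestedInvariant T hE) hV

end OneLevelAverage

end Literature.MathematicalPhysics.QuantumFieldTheory.Balaban1983to89.B12RegularClassInvariance263
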